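/-
Origin: expansion seat `prover-pub-hodgecm-mc-binder-2-g12-0`, handover #57 2026-08-20T05:58Z md5 207b273f8a31 (238 l.; CERTIFIED private mirror over PKG RUN-39/40 oleans: rc 0 / 0 err / 0 warn / 59 s; `#print axioms` of cmKTypeTwist_pin_eq_map · SK_wmInputCM₂g_eq_span · eq_sum_tmul_of_mem_SK_wmInputCM₂g · cmPairRepTwist_archProdHom_apply ⊆ {propext, Classical.choice, Quot.sound} (`g12/certs/axioms-57.log`); imports binder-2 #40 `HypCensus/ArchFrameConj` (RUN 39), carch-1 `Model/ArchKTypeOfArch` (RUN 38), K-1 `Vendored/H21/RepresentationTheory/WeightSpaceTensorCoordinates` (RUN 35, the tree file EARMARKED for rows A12/A34 field `dense`); (J-dense) STEPS (i)+(ii) WITH NO HYPOTHESIS — `𝒮^κ` AT THE W PIN IS `𝒮_∞^κ ⊗ 𝒮(𝔸_f^6)`: §1 `piSchwartzBruhatEquiv_rTensor` (`E ∘ (A ⊗ 1) = adelicTensorEnd A id ∘ E`), `map_range_rTensor_subtype_eq_span` (`E (P ⊗ 𝒮_f) = span {E (Φ_∞ ⊗ f) : Φ_∞ ∈ P}`);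 §2 `archPairOf k := (frameG⁻¹ k frameG, 1)`, **`archKOp k := η(archProdHom (archPairOf k)) • cmArchWeilRep (archPairOf k)`** (the archimedean K_∞-operator family), **`archSK := jointEigenspace archKOp archKappa`** (THE ARCHIMEDEAN κ-ISOTYPIC SUBSPACE `𝒮_∞^κ ⊆ 𝓢((Fin 6 → L⁺⊗ℝ), ℂ)`), `mem_archSK`, `cmPairRepTwist_archProdHom_apply` (`ρ_η(archProdHom p) = (η(p_𝔸) • ω_∞(p)) ⊗ 1`, carch-1 `smul_cmPairRep_archToAdelic_eq_adelicTensorEnd` twisted), `kTypePair_eq_archProdHom` (`(cmKTypeHom k_𝔸, 1) = archProdHom (archPairOf k)`, #40), `cmPairRepTwist_kTypePair_piSchwartzBruhatEquiv` (`ρ_η(k-pair) (E z) = E ((archKOp k ⊗ 1) z)` — K_∞ acts through the archimedean factor), **`cmKTypeTwist_pin_eq_map : cmKTypeTwist … (archKappa …) = (range (archSK.subtype ⊗ 1)).map E`** (tree `weightSpace_eq_map_range_rTensor`), **`SK_wmInputCM₂g_eq`** / **`SK_wmInputCM₂g_eq_span : W₀.SK = span_ℂ {E (Φ_∞ ⊗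 f) : Φ_∞ ∈ archSK, f : FinSB}`** at `W₀ = wmInputCM₂g V S hGR η hη hηc τ T hT` (ANY frame τ T hT; no hV, no sign fact), `mem_span_tensor_of_mem_SK_wmInputCM₂g`, `tensor_mem_SK_wmInputCM₂g`, `eq_sum_tmul_of_mem_SK_wmInputCM₂g` (finite-sum form over any basis of `𝒮(𝔸_f^6)`); CONSEQUENCE for the census field `dense`: it now reduces to the ARCHIMEDEAN statement `archSK ⊆ closure_𝓢 span{archimedean printed images}` + (J-top) #7 continuity — (J-dense) steps (iii)–(v) of HANDOFF-g12 §3b; 0 Prop-defs / 0 records / 0 proof-hole-class tokens; FQN scan vs PKG RUN-41 world + all mc/*/pkg + stage42: 0 collisions; NAME LIST `HodgeCM.Model.HypCensus.SK_wmInputCM₂g_eq_span` · `HodgeCM.Model.HypCensus.cmKTypeTwist_pin_eq_map` · `HodgeCM.Model.HypCensus.archSK`) (`HOME/mc/pub-hodgecm-mc-binder-2/g12/pkg/HodgeCM/Model/HypCensus/DenseTensor.lean`, md5 207b273f8a31, 238 lines);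
landed by the second packager p2 gen 3 (p2-g3) in gate run 42 as `HodgeCM/Model/HypCensus/DenseTensor.lean` (verbatim).
-/
/-
Copyright (c) 2026. All rights reserved.
Released under Apache 2.0 license as described in the file LICENSE.
-/
import Literature.RepresentationTheory.WeightSpaceTensorCoordinates
import Summits.HodgeConjecture.HodgeCM.Model.HypCensus.ArchFrameConj
import Summits.HodgeConjecture.HodgeCM.Model.ArchKTypeOfArch

/-!
# (J-dense), step (i)–(ii): `𝒮^κ` at the W pin IS `𝒮_∞^κ ⊗ 𝒮(𝔸_f^6)`

Binder-2 lineage, rows 18/19 (`hyp12`/`hyp34`), field `dense` of `HypCoreW`.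

The adelic Schwartz–Bruhat space is the ALGEBRAIC tensor product `𝓢((L⁺ ⊗ ℝ)^6) ⊗_ℂ 𝒮(𝔸_{L⁺,f}^6)` (tree
`piSchwartzBruhatEquiv`), and `K_∞` acts on it through the archimedean factor:
`ρ_η((g⁻¹kg)_𝔸, 1) (Φ_∞ ⊗ f) = (η((g⁻¹kg)_𝔸, 1) • ω_∞(g⁻¹kg, 1) Φ_∞) ⊗ f` (carch-1 `cmPairRep_archToAdelic_eq_adelicTensorEnd`
+ binder-2 #40 `cmKTypeHom_archToAdelic`).  The tree's `Literature.RepresentationTheory.weightSpace_eq_map_range_rTensor`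
(weight spaces in a tensor model with free second factor) then gives, with NO hypothesis,

* `cmKTypeTwist_pin_eq_map` / `SK_wmInputCM₂g_eq`: `W₀.SK = E (archSK ⊗ 𝒮(𝔸_f^6))`, where
  `archSK = {Φ_∞ | ∀ k ∈ K_∞, archKOp k Φ_∞ = κ(k) • Φ_∞}` is the archimedean `κ`-isotypic subspace and
  `E = piSchwartzBruhatEquiv`;
* `SK_wmInputCM₂g_eq_span`: `W₀.SK = span_ℂ {E (Φ_∞ ⊗ f) | Φ_∞ ∈ archSK, f ∈ 𝒮(𝔸_f^6)}`, and the two membership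
  forms `mem_span_tensor_of_mem_SK_wmInputCM₂g`, `tensor_mem_SK_wmInputCM₂g`.

This reduces (J-dense) to the archimedean factor (tree `SegalBargmann/SchwartzIsotypicFockPolynomials` place by place).
[folklore]
-/

noncomputable section

open NumberField NumberField.mixedEmbedding IsDedekindDomain
open scoped TensorProduct SchwartzMap Classical
open Literature.NumberTheory.Automorphic Literature.NumberTheory.Automorphic.UnitaryGroup
open Literature.NumberTheory.GelbartRogawski1991 Literature.NumberTheory.GelbartRogawski1991.UnitaryDualPair
open Literature.RepresentationTheory

namespace HodgeCM.Model.HypCensus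

/-! ## §1 generic: `A ⊗ 1` in the tensor model, and the span form of `E (P ⊗ N)` -/

section Generic

variable {K : Type} [Field K] [NumberField K] {ι : Type} [Fintype ι]

/-- `adelicTensorEnd A 1` is `A ⊗ 1 = A.rTensor` transported along `piSchwartzBruhatEquiv`. [folklore] -/
theorem piSchwartzBruhatEquiv_rTensor (A : 𝓢((ι → mixedSpace K), ℂ) →ₗ[ℂ] 𝓢((ι → mixedSpace K), ℂ))
    (x : 𝓢((ι → mixedSpace K), ℂ) ⊗[ℂ] FinSB K ι) :
    piSchwartzBruhatEquiv K ι (A.rTensor (FinSB K ι) x) =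
      adelicTensorEnd A LinearMap.id (piSchwartzBruhatEquiv K ι x) := by
  simp only [adelicTensorEnd, LinearMap.comp_apply, LinearEquiv.coe_toLinearMap,
    LinearEquiv.symm_apply_apply, LinearMap.rTensor]

/-- **Span form of `E (P ⊗ 𝒮_f)`**: the image under `E = piSchwartzBruhatEquiv` of `P ⊗ 𝒮(𝔸_f^ι)` (the range of
`P.subtype ⊗ 1`) is the `ℂ`-span of the factorizable functions `E (Φ_∞ ⊗ f)`, `Φ_∞ ∈ P`. [folklore] -/
theorem map_range_rTensor_subtype_eq_span (P : Submodule ℂ 𝓢((ι → mixedSpace K), ℂ)) :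
    (LinearMap.range (P.subtype.rTensor (FinSB K ι))).map
        (piSchwartzBruhatEquiv K ι : 𝓢((ι → mixedSpace K), ℂ) ⊗[ℂ] FinSB K ι →ₗ[ℂ] ↥(piSchwartzBruhat K ι)) =
      Submodule.span ℂ {Ψ : ↥(piSchwartzBruhat K ι) | ∃ Φinf ∈ P, ∃ f : FinSB K ι,
        Ψ = piSchwartzBruhatEquiv K ι (Φinf ⊗ₜ f)} := by
  refine le_antisymm ?_ ?_
  · rintro _ ⟨z, ⟨y, rfl⟩, rfl⟩
    induction y using TensorProduct.induction_on with
    | zero => simp only [map_zero, Submodule.zero_mem]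
    | tmul p f =>
        rw [LinearMap.rTensor_tmul, Submodule.coe_subtype, LinearEquiv.coe_coe]
        exact Submodule.subset_span ⟨p, p.2, f, rfl⟩
    | add y y' hy hy' => simpa only [map_add] using Submodule.add_mem _ hy hy'
  · rw [Submodule.span_le]
    rintro _ ⟨Φinf, hΦ, f, rfl⟩
    refine ⟨P.subtype.rTensor (FinSB K ι) ((⟨Φinf, hΦ⟩ : P) ⊗ₜ f), ⟨_, rfl⟩, ?_⟩
    rw [LinearMap.rTensor_tmul]
    rfl

end Generic

/-! ## §2 at the W pin of record (no hypothesis) -/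

section Pin

open HodgeCM HodgeCM.Model

variable {L : CMField} {ι₁ : L →+* ℂ} (V : HermSpace3 L ι₁) (S : StubTree.SeesawDatum L)
variable
  (hGR : (cmSplittingDatum (L : Type) finProdFinEquiv (frameD V) (frameD_real V) (frameD_ne V) (dW S) (dW_real S) (dW_ne S)).CompatibleSplitting)
  (η : CMAdelic (L : Type) (frameD V) × CMAdelic (L : Type) (dW S) →* ℂˣ)
  (hη : ∀ γU ∈ CMRat (L : Type) (frameD V), ∀ γ ∈ CMRat (L : Type) (dW S), η (γU, γ) = 1)
  (hηc : Continuous fun p => ((η p : ℂˣ) : ℂ))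
  (τ : L →+* ℂ) (T : GL (Fin 3) ℂ)
  (hT : formCongr (starRingEnd ℂ) T (V.Hm.map τ) = Literature.Geometry.ComplexHyperbolic.BallModel.J)

/-- The archimedean pair element `(g⁻¹ k g, 1) ∈ U(diag frameD)(L⊗ℝ) × U(diag dW)(L⊗ℝ)` attached to `k ∈ K_∞`. -/
abbrev archPairOf (k : ↥(UnitaryGroup.archIsotropy (L : Type) V.Hm τ T hT)) :
    UnitaryGroup.arch (↥(maximalRealSubfield L)) (L : Type) (IsCMField.complexConj L) 3 (Matrix.diagonal (frameD V)) ×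
      UnitaryGroup.arch (↥(maximalRealSubfield L)) (L : Type) (IsCMField.complexConj L) 2 (Matrix.diagonal (dW S)) :=
  (archFrameConj (L : Type) 3 V.Hm (frameG V) (frameD V) (frame_congr V)
      (k : ↥(UnitaryGroup.arch (↥(maximalRealSubfield L)) (L : Type) (IsCMField.complexConj L) 3 V.Hm)),
    (1 : ↥(UnitaryGroup.arch (↥(maximalRealSubfield L)) (L : Type) (IsCMField.complexConj L) 2 (Matrix.diagonal (dW S)))))

/-- **The archimedean `K_∞`-operator family of the W pin**: `k ↦ η((g⁻¹kg)_𝔸, 1) • ω_∞(g⁻¹kg, 1)` on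
`𝓢((Fin 6 → L⁺ ⊗ ℝ), ℂ)`. -/
def archKOp (k : ↥(UnitaryGroup.archIsotropy (L : Type) V.Hm τ T hT)) :
    Module.End ℂ 𝓢((Fin 6 → mixedSpace (↥(maximalRealSubfield L))), ℂ) :=
  ((η (archProdHom (↥(maximalRealSubfield L)) (L : Type) (IsCMField.complexConj L) 3 2 (Matrix.diagonal (frameD V))
      (Matrix.diagonal (dW S)) (archPairOf V S τ T hT k)) : ℂˣ) : ℂ) •
    (cmArchWeilRep (L : Type) finProdFinEquiv (frameD V) (frameD_real V) (frameD_ne V) (dW S) (dW_real S) (dW_ne S) hGR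
      (archPairOf V S τ T hT k) : 𝓢((Fin 6 → mixedSpace (↥(maximalRealSubfield L))), ℂ) →ₗ[ℂ] _)

/-- **The archimedean `κ`-isotypic subspace of the W pin** `𝒮_∞^κ ⊆ 𝓢((Fin 6 → L⁺ ⊗ ℝ), ℂ)`:
the joint eigenspace `{Φ_∞ | ∀ k ∈ K_∞, archKOp k Φ_∞ = κ(k) • Φ_∞}`. -/
def archSK : Submodule ℂ 𝓢((Fin 6 → mixedSpace (↥(maximalRealSubfield L))), ℂ) :=
  jointEigenspace (archKOp V S hGR η τ T hT)
    fun k => ((UnitaryGroup.archKappa (L : Type) V.Hm τ T hT k : ℂˣ) : ℂ)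

/-- Membership in `archSK`. -/
theorem mem_archSK {Φinf : 𝓢((Fin 6 → mixedSpace (↥(maximalRealSubfield L))), ℂ)} :
    Φinf ∈ archSK V S hGR η τ T hT ↔
      ∀ k : ↥(UnitaryGroup.archIsotropy (L : Type) V.Hm τ T hT),
        archKOp V S hGR η τ T hT k Φinf = ((UnitaryGroup.archKappa (L : Type) V.Hm τ T hT k : ℂˣ) : ℂ) • Φinf :=
  mem_jointEigenspace

/-- `ρ_η (archProdHom p) Ψ = (η(p_𝔸) • ω_∞(p) ⊗ 1) Ψ` for archimedean pairs `p` (carch-1's tensor identity, twisted). -/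
theorem cmPairRepTwist_archProdHom_apply
    (p : UnitaryGroup.arch (↥(maximalRealSubfield L)) (L : Type) (IsCMField.complexConj L) 3 (Matrix.diagonal (frameD V)) ×
      UnitaryGroup.arch (↥(maximalRealSubfield L)) (L : Type) (IsCMField.complexConj L) 2 (Matrix.diagonal (dW S)))
    (Ψ : CMSchwartz (L : Type) 6) :
    cmPairRepTwist (L : Type) finProdFinEquiv (frameD V) (frameD_real V) (frameD_ne V) (dW S) (dW_real S) (dW_ne S) hGR η
        (archProdHom (↥(maximalRealSubfield L)) (L : Type) (IsCMField.complexConj L) 3 2 (Matrix.diagonal (frameD V))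
          (Matrix.diagonal (dW S)) p) Ψ =
      adelicTensorEnd
        (((η (archProdHom (↥(maximalRealSubfield L)) (L : Type) (IsCMField.complexConj L) 3 2
            (Matrix.diagonal (frameD V)) (Matrix.diagonal (dW S)) p) : ℂˣ) : ℂ) •
          (cmArchWeilRep (L : Type) finProdFinEquiv (frameD V) (frameD_real V) (frameD_ne V) (dW S) (dW_real S)
            (dW_ne S) hGR p : 𝓢((Fin 6 → mixedSpace (↥(maximalRealSubfield L))), ℂ) →ₗ[ℂ] _))
        LinearMap.id Ψ := by
  obtain ⟨x, y⟩ := p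
  have hq : archProdHom (↥(maximalRealSubfield L)) (L : Type) (IsCMField.complexConj L) 3 2 (Matrix.diagonal (frameD V))
        (Matrix.diagonal (dW S)) (x, y) =
      (archToAdelic (↥(maximalRealSubfield L)) (L : Type) (IsCMField.complexConj L) 3 (Matrix.diagonal (frameD V)) x,
        archToAdelic (↥(maximalRealSubfield L)) (L : Type) (IsCMField.complexConj L) 2 (Matrix.diagonal (dW S)) y) := rfl
  rw [hq, cmPairRepTwist_apply_eq_smul]
  exact LinearMap.congr_fun (smul_cmPairRep_archToAdelic_eq_adelicTensorEnd (L : Type) finProdFinEquiv (frameD V)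
    (frameD_real V) (frameD_ne V) (dW S) (dW_real S) (dW_ne S) hGR _ x y) Ψ

/-- The `K_∞`-test element `(cmKTypeHom (k_𝔸), 1)` of `cmKTypeTwist` IS `archProdHom (g⁻¹kg, 1)` (#40 `cmKTypeHom_archToAdelic`). -/
theorem kTypePair_eq_archProdHom (k : ↥(UnitaryGroup.archIsotropy (L : Type) V.Hm τ T hT)) :
    ((cmKTypeHom (L : Type) V.Hm (frameG V) (frameD V) (frame_congr V)
        (UnitaryGroup.archIsotropyToAdelic (L : Type) V.Hm τ T hT k), (1 : CMAdelic (L : Type) (dW S))) :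
        CMAdelic (L : Type) (frameD V) × CMAdelic (L : Type) (dW S)) =
      archProdHom (↥(maximalRealSubfield L)) (L : Type) (IsCMField.complexConj L) 3 2 (Matrix.diagonal (frameD V))
        (Matrix.diagonal (dW S)) (archPairOf V S τ T hT k) := by
  refine Prod.ext ?_ (map_one (archToAdelic (↥(maximalRealSubfield L)) (L : Type) (IsCMField.complexConj L) 2
    (Matrix.diagonal (dW S)))).symm
  change cmKTypeHom (L : Type) V.Hm (frameG V) (frameD V) (frame_congr V)
      (archToAdelic (↥(maximalRealSubfield L)) (L : Type) (IsCMField.complexConj L) 3 V.Hm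
        (k : ↥(UnitaryGroup.arch (↥(maximalRealSubfield L)) (L : Type) (IsCMField.complexConj L) 3 V.Hm))) = _
  rw [cmKTypeHom_archToAdelic]
  rfl

/-- **`K_∞` acts through the archimedean factor**: `ρ_η(k_𝔸-pair) (E z) = E ((archKOp k ⊗ 1) z)`. -/
theorem cmPairRepTwist_kTypePair_piSchwartzBruhatEquiv (k : ↥(UnitaryGroup.archIsotropy (L : Type) V.Hm τ T hT))
    (z : 𝓢((Fin 6 → mixedSpace (↥(maximalRealSubfield L))), ℂ) ⊗[ℂ] FinSB (↥(maximalRealSubfield L)) (Fin 6)) :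
    cmPairRepTwist (L : Type) finProdFinEquiv (frameD V) (frameD_real V) (frameD_ne V) (dW S) (dW_real S) (dW_ne S) hGR η
        ((cmKTypeHom (L : Type) V.Hm (frameG V) (frameD V) (frame_congr V)
          (UnitaryGroup.archIsotropyToAdelic (L : Type) V.Hm τ T hT k), (1 : CMAdelic (L : Type) (dW S))))
        (piSchwartzBruhatEquiv (↥(maximalRealSubfield L)) (Fin 6) z) =
      piSchwartzBruhatEquiv (↥(maximalRealSubfield L)) (Fin 6) ((archKOp V S hGR η τ T hT k).rTensor _ z) := by
  rw [kTypePair_eq_archProdHom, cmPairRepTwist_archProdHom_apply, piSchwartzBruhatEquiv_rTensor]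
  rfl

/-- **`𝒮^κ = E (𝒮_∞^κ ⊗ 𝒮(𝔸_f^6))`** (submodule form): the `κ`-isotypic `K_∞`-type of the normalised pair
representation at the frame of record is the image under `E = piSchwartzBruhatEquiv` of `archSK ⊗ 𝒮(𝔸_f^6)`
(tree `weightSpace_eq_map_range_rTensor`; NO hypothesis). [folklore] -/
theorem cmKTypeTwist_pin_eq_map :
    cmKTypeTwist (L : Type) finProdFinEquiv (frameD V) (frameD_real V) (frameD_ne V) (dW S) (dW_real S) (dW_ne S) hGR η
        V.Hm (frameG V) (frame_congr V) τ T hT (UnitaryGroup.archKappa (L : Type) V.Hm τ T hT) =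
      (LinearMap.range ((archSK V S hGR η τ T hT).subtype.rTensor (FinSB (↥(maximalRealSubfield L)) (Fin 6)))).map
        (piSchwartzBruhatEquiv (↥(maximalRealSubfield L)) (Fin 6) :
          𝓢((Fin 6 → mixedSpace (↥(maximalRealSubfield L))), ℂ) ⊗[ℂ] FinSB (↥(maximalRealSubfield L)) (Fin 6) →ₗ[ℂ]
            CMSchwartz (L : Type) 6) :=
  weightSpace_eq_map_range_rTensor _ (archKOp V S hGR η τ T hT)
    (cmPairRepTwist_kTypePair_piSchwartzBruhatEquiv V S hGR η τ T hT)

/-- **`W₀.SK = E (𝒮_∞^κ ⊗ 𝒮(𝔸_f^6))`** at the W pin of record `W₀ = wmInputCM₂g …` (set form; NO hypothesis). -/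
theorem SK_wmInputCM₂g_eq :
    (wmInputCM₂g V S hGR η hη hηc τ T hT).SK =
      ((LinearMap.range ((archSK V S hGR η τ T hT).subtype.rTensor (FinSB (↥(maximalRealSubfield L)) (Fin 6)))).map
        (piSchwartzBruhatEquiv (↥(maximalRealSubfield L)) (Fin 6) :
          𝓢((Fin 6 → mixedSpace (↥(maximalRealSubfield L))), ℂ) ⊗[ℂ] FinSB (↥(maximalRealSubfield L)) (Fin 6) →ₗ[ℂ]
            CMSchwartz (L : Type) 6) : Set (CMSchwartz (L : Type) 6)) :=
  congrArg (fun M : Submodule ℂ (CMSchwartz (L : Type) 6) => (M : Set (CMSchwartz (L : Type) 6)))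
    (cmKTypeTwist_pin_eq_map V S hGR η τ T hT)

/-- **`W₀.SK = span_ℂ {E (Φ_∞ ⊗ f) | Φ_∞ ∈ 𝒮_∞^κ, f ∈ 𝒮(𝔸_f^6)}`** (span form; NO hypothesis). [folklore] -/
theorem SK_wmInputCM₂g_eq_span :
    (wmInputCM₂g V S hGR η hη hηc τ T hT).SK =
      (Submodule.span ℂ
        {Φ : CMSchwartz (L : Type) 6 | ∃ Φinf ∈ archSK V S hGR η τ T hT,
          ∃ f : FinSB (↥(maximalRealSubfield L)) (Fin 6),
            Φ = piSchwartzBruhatEquiv (↥(maximalRealSubfield L)) (Fin 6) (Φinf ⊗ₜ f)} :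
        Set (CMSchwartz (L : Type) 6)) := by
  rw [SK_wmInputCM₂g_eq, map_range_rTensor_subtype_eq_span]

/-- Membership form of `SK_wmInputCM₂g_eq_span` (⇒). -/
theorem mem_span_tensor_of_mem_SK_wmInputCM₂g (Ψ : CMSchwartz (L : Type) 6)
    (hΨ : Ψ ∈ (wmInputCM₂g V S hGR η hη hηc τ T hT).SK) :
    Ψ ∈ Submodule.span ℂ
      {Φ : CMSchwartz (L : Type) 6 | ∃ Φinf ∈ archSK V S hGR η τ T hT,
        ∃ f : FinSB (↥(maximalRealSubfield L)) (Fin 6),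
          Φ = piSchwartzBruhatEquiv (↥(maximalRealSubfield L)) (Fin 6) (Φinf ⊗ₜ f)} := by
  rw [SK_wmInputCM₂g_eq_span] at hΨ
  exact hΨ

/-- Membership form (⇐): every `E (Φ_∞ ⊗ f)` with `Φ_∞ ∈ 𝒮_∞^κ` lies in `W₀.SK`. -/
theorem tensor_mem_SK_wmInputCM₂g {Φinf : 𝓢((Fin 6 → mixedSpace (↥(maximalRealSubfield L))), ℂ)}
    (hinf : Φinf ∈ archSK V S hGR η τ T hT) (f : FinSB (↥(maximalRealSubfield L)) (Fin 6)) :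
    (piSchwartzBruhatEquiv (↥(maximalRealSubfield L)) (Fin 6) (Φinf ⊗ₜ f) : CMSchwartz (L : Type) 6) ∈
      (wmInputCM₂g V S hGR η hη hηc τ T hT).SK := by
  rw [SK_wmInputCM₂g_eq_span]
  exact Submodule.subset_span ⟨Φinf, hinf, f, rfl⟩

/-- **Finite-sum form**: every `Ψ ∈ W₀.SK` is `Σ_i E (x_i ⊗ 𝒞_i)` over the coordinates of `E⁻¹ Ψ` in any basis `𝒞`
of `𝒮(𝔸_f^6)`, with every `x_i ∈ 𝒮_∞^κ` (tree `eq_sum_tmul_of_mem_weightSpace`). -/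
theorem eq_sum_tmul_of_mem_SK_wmInputCM₂g {κι : Type*} (𝒞 : Module.Basis κι ℂ (FinSB (↥(maximalRealSubfield L)) (Fin 6)))
    {Ψ : CMSchwartz (L : Type) 6} (hΨ : Ψ ∈ (wmInputCM₂g V S hGR η hη hηc τ T hT).SK) :
    (∀ i, TensorProduct.equivFinsuppOfBasisRight 𝒞
        ((piSchwartzBruhatEquiv (↥(maximalRealSubfield L)) (Fin 6)).symm Ψ) i ∈ archSK V S hGR η τ T hT) ∧
      Ψ = (TensorProduct.equivFinsuppOfBasisRight 𝒞
          ((piSchwartzBruhatEquiv (↥(maximalRealSubfield L)) (Fin 6)).symm Ψ)).sum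
        fun i x => piSchwartzBruhatEquiv (↥(maximalRealSubfield L)) (Fin 6) (x ⊗ₜ 𝒞 i) :=
  eq_sum_tmul_of_mem_weightSpace 𝒞 _ (archKOp V S hGR η τ T hT)
    (cmPairRepTwist_kTypePair_piSchwartzBruhatEquiv V S hGR η τ T hT) hΨ

end Pin

end HodgeCM.Model.HypCensus

end
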